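import Literature.Analysis.Fourier.ChirpAliasKernel
import HarnessLib

/-!
# Alias kernels of a super-Nyquist chirp: the `k`-summed smooth kernel

Continuation of `ChirpAliasKernel.lean`. With the Fourier coefficients `b_k = (4π²k²)⁻¹` of the
periodic Bernoulli function and the symmetric truncated kernels
`P_T(k) = K_T(k) + K_T(-k)` (`aliasPairT`), the cut-off partial sums
`S_m = Σ_{k=1}^{m} b_k χ P_{m+1}(k)` (`aliasSum`; `χ` smooth, supported in `[-c', c']`,
`c' < 2πL`) are smooth and all their derivatives are uniformly Cauchy on `ℝ` (uniform `C^l`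
bounds `O(1)` of the kernels, tails `Σ_{k>m} b_k → 0`, truncation error `O(m^{-1/2})`), hence
converge uniformly with all derivatives to a smooth kernel
(`exists_contDiff_tendstoUniformly_aliasSum`). We also record the Fubini pairing of `P_T(k)`
with a Fourier transform (`integral_ft_mul_truncAmp_pair`) and the uniform bound
`‖P_T(k)(x)‖ ≤ C` (`exists_aliasPairT_le`). Source: Stein, *Harmonic Analysis* (1993),
VIII §1; Rudin, *Principles*, Thm 7.17. All proved; the definitions are abbreviations.
-/

noncomputable section

open Set Filter MeasureTheory
open scoped Topology ContDiff Real

namespace Literature.Analysis.Fourier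

open _root_.Complex (I exp)

/-! ## Abstract bookkeeping: uniformly Cauchy truncated sums -/

/-- **Bookkeeping lemma.** If `‖D_T(k, x) − D_{T'}(k, x)‖ ≤ A (min T T')^{-1/2}` and
`‖D_T(k, x)‖ ≤ B` for `T, T' ≥ 1`, and `c ≥ 0` is summable, then the truncated sums
`Σ_{k<m} c_k D_{m+1}(k, x)` are uniformly Cauchy in `x`. [folklore] -/
theorem uniformCauchy_sum_of_bounds {D : ℝ → ℕ → ℝ → ℂ} {A B : ℝ} {c : ℕ → ℝ}
    (hc0 : ∀ k, 0 ≤ c k) (hc : Summable c) (hA0 : 0 ≤ A) (hB0 : 0 ≤ B)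
    (hA : ∀ k x T T', 1 ≤ T → 1 ≤ T' → ‖D T k x - D T' k x‖ ≤ A * (min T T') ^ (-(1 / 2) : ℝ))
    (hB : ∀ k x T, 1 ≤ T → ‖D T k x‖ ≤ B) :
    ∀ ε > (0 : ℝ), ∃ N : ℕ, ∀ m ≥ N, ∀ m' ≥ N, ∀ x : ℝ,
      ‖∑ k ∈ Finset.range m, (c k : ℂ) * D (m + 1) k x -
        ∑ k ∈ Finset.range m', (c k : ℂ) * D (m' + 1) k x‖ < ε := by
  set s : ℕ → ℝ := fun m => ∑ k ∈ Finset.range m, c k with hs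
  set S : ℝ := ∑' k, c k with hS
  have hsS : ∀ m, s m ≤ S := fun m => hc.sum_le_tsum _ fun k _ => hc0 k
  have hS0 : 0 ≤ S := tsum_nonneg hc0
  -- the key estimate for `m ≤ m'`
  have key : ∀ m m', m ≤ m' → ∀ x,
      ‖∑ k ∈ Finset.range m', (c k : ℂ) * D (m' + 1) k x -
        ∑ k ∈ Finset.range m, (c k : ℂ) * D (m + 1) k x‖ ≤
        A * S * ((m : ℝ) + 1) ^ (-(1 / 2) : ℝ) + B * (s m' - s m) := by
    intro m m' hmm' x
    have hm1 : (1 : ℝ) ≤ m + 1 := by linarith [(Nat.cast_nonneg m : (0 : ℝ) ≤ m)]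
    have hm1' : (1 : ℝ) ≤ m' + 1 := by linarith [(Nat.cast_nonneg m' : (0 : ℝ) ≤ m')]
    rw [← Finset.sum_range_add_sum_Ico _ hmm', add_sub_right_comm, ← Finset.sum_sub_distrib]
    have hmin : min ((m' : ℝ) + 1) ((m : ℝ) + 1) = (m : ℝ) + 1 :=
      min_eq_right (by exact_mod_cast Nat.succ_le_succ hmm')
    calc ‖∑ k ∈ Finset.range m, ((c k : ℂ) * D (m' + 1) k x - (c k : ℂ) * D (m + 1) k x) +
          ∑ k ∈ Finset.Ico m m', (c k : ℂ) * D (m' + 1) k x‖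
        ≤ ∑ k ∈ Finset.range m, ‖(c k : ℂ) * D (m' + 1) k x - (c k : ℂ) * D (m + 1) k x‖ +
          ∑ k ∈ Finset.Ico m m', ‖(c k : ℂ) * D (m' + 1) k x‖ :=
          (norm_add_le _ _).trans (add_le_add (norm_sum_le _ _) (norm_sum_le _ _))
      _ ≤ ∑ k ∈ Finset.range m, c k * (A * ((m : ℝ) + 1) ^ (-(1 / 2) : ℝ)) +
          ∑ k ∈ Finset.Ico m m', c k * B := by
          gcongr with k _ k _
          · rw [← mul_sub, norm_mul, Complex.norm_real, Real.norm_of_nonneg (hc0 k)]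
            refine mul_le_mul_of_nonneg_left ?_ (hc0 k)
            have := hA k x ((m' : ℝ) + 1) ((m : ℝ) + 1) hm1' hm1
            rwa [hmin] at this
          · rw [norm_mul, Complex.norm_real, Real.norm_of_nonneg (hc0 k)]
            refine mul_le_mul_of_nonneg_left ?_ (hc0 k)
            exact hB k x ((m' : ℝ) + 1) hm1'
      _ = A * s m * ((m : ℝ) + 1) ^ (-(1 / 2) : ℝ) + B * (s m' - s m) := by
          rw [← Finset.sum_mul, ← Finset.sum_mul, hs]
          simp only
          rw [← Finset.sum_range_add_sum_Ico _ hmm']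
          ring
      _ ≤ A * S * ((m : ℝ) + 1) ^ (-(1 / 2) : ℝ) + B * (s m' - s m) := by
          gcongr
          exact hsS m
  -- choose `N`
  intro ε hε
  have ht : Tendsto (fun m : ℕ => A * S * ((m : ℝ) + 1) ^ (-(1 / 2) : ℝ)) atTop (𝓝 0) := by
    have h1 : Tendsto (fun m : ℕ => (m : ℝ) + 1) atTop atTop :=
      tendsto_atTop_add_const_right _ 1 tendsto_natCast_atTop_atTop
    have h2 := ((tendsto_rpow_neg_atTop (by norm_num : (0 : ℝ) < 1 / 2)).comp h1).const_mul
      (A * S)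
    simpa using h2
  obtain ⟨N₁, hN₁⟩ := (ht.eventually (gt_mem_nhds (show (0 : ℝ) < ε / 2 by linarith))).exists_forall_of_atTop
  have hcs : CauchySeq s := hc.hasSum.tendsto_sum_nat.cauchySeq
  obtain ⟨N₂, hN₂⟩ := Metric.cauchySeq_iff.1 hcs (ε / (2 * (B + 1))) (by positivity)
  refine ⟨max N₁ N₂, fun m hm m' hm' x => ?_⟩
  have hB1 : B * (ε / (2 * (B + 1))) ≤ ε / 2 := by
    rw [mul_div_assoc', div_le_div_iff₀ (by positivity) (by positivity)]
    nlinarith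
  rcases le_total m m' with h | h
  · rw [norm_sub_rev]
    refine (key m m' h x).trans_lt ?_
    have e1 := hN₁ m (le_of_max_le_left hm)
    have e2 := hN₂ m' (le_of_max_le_right hm') m (le_of_max_le_right hm)
    rw [Real.dist_eq] at e2
    have e3 : s m' - s m ≤ ε / (2 * (B + 1)) := (le_abs_self _).trans e2.le
    nlinarith [mul_le_mul_of_nonneg_left e3 hB0]
  · refine (key m' m h x).trans_lt ?_
    have e1 := hN₁ m' (le_of_max_le_left hm')
    have e2 := hN₂ m (le_of_max_le_right hm) m' (le_of_max_le_right hm')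
    rw [Real.dist_eq] at e2
    have e3 : s m - s m' ≤ ε / (2 * (B + 1)) := (le_abs_self _).trans e2.le
    nlinarith [mul_le_mul_of_nonneg_left e3 hB0]

/-! ## The symmetric truncated kernels and the partial sums -/

/-- The symmetric truncated alias kernel `P_T(k)(x) = K_T(k)(x) + K_T(-k)(x)`. [folklore] -/
def aliasPairT (φ : ℝ → ℝ) (H : ℝ) (w : ℝ → ℝ) (T : ℝ) (k : ℤ) (x : ℝ) : ℂ :=
  aliasKT φ H (truncAmp H w T) k x + aliasKT φ H (truncAmp H w T) (-k) x

/-- The Fourier coefficients `b_k = (4π²(k+1)²)⁻¹` (`k ≥ 0`; mode `k + 1`). [folklore] -/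
def b2coef (k : ℕ) : ℝ := (4 * π ^ 2 * ((k : ℝ) + 1) ^ 2)⁻¹

/-- The cut-off partial sums `S_m(x) = Σ_{k<m} b_k χ(x) P_{m+1}(k+1)(x)`. [folklore] -/
def aliasSum (φ : ℝ → ℝ) (H : ℝ) (w : ℝ → ℝ) (χ : ℝ → ℂ) (m : ℕ) (x : ℝ) : ℂ :=
  ∑ k ∈ Finset.range m, (b2coef k : ℂ) * (χ x * aliasPairT φ H w (m + 1) (k + 1) x)

/-- `b_k ≥ 0`. [folklore] -/
theorem b2coef_nonneg (k : ℕ) : 0 ≤ b2coef k := by unfold b2coef; positivity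

/-- `Σ b_k < ∞`. [folklore] -/
theorem summable_b2coef : Summable b2coef := by
  have h : Summable fun k : ℕ => 1 / ((k + 1 : ℕ) : ℝ) ^ 2 :=
    (summable_nat_add_iff 1).mpr (Real.summable_one_div_nat_pow.mpr one_lt_two)
  refine (h.mul_left (4 * π ^ 2)⁻¹).congr fun k => ?_
  show (4 * π ^ 2)⁻¹ * (1 / ((k + 1 : ℕ) : ℝ) ^ 2) = (4 * π ^ 2 * ((k : ℝ) + 1) ^ 2)⁻¹
  push_cast
  rw [one_div, ← mul_inv]

section Pair

variable {φ : ℝ → ℝ} {H : ℝ} {w : ℝ → ℝ}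

/-- `P_T(k)` is smooth. [folklore] -/
theorem contDiff_aliasPairT (hφ : Continuous φ) (hwc : Continuous w) {T : ℝ} (hT : 0 < T)
    (k : ℤ) : ContDiff ℝ ∞ (aliasPairT φ H w T k) :=
  (contDiff_aliasKT_truncAmp hφ hwc hT k).add (contDiff_aliasKT_truncAmp hφ hwc hT (-k))

/-- Derivatives of `P_T(k)`. [folklore] -/
theorem iteratedDeriv_aliasPairT (hφ : Continuous φ) (hwc : Continuous w) {T : ℝ} (hT : 0 < T)
    (k : ℤ) (j : ℕ) (x : ℝ) : iteratedDeriv j (aliasPairT φ H w T k) x =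
      iteratedDeriv j (aliasKT φ H (truncAmp H w T) k) x +
        iteratedDeriv j (aliasKT φ H (truncAmp H w T) (-k)) x := by
  have h1 : ContDiffAt ℝ j (aliasKT φ H (truncAmp H w T) k) x :=
    (contDiff_aliasKT_truncAmp (H := H) hφ hwc hT k).contDiffAt.of_le (mod_cast le_top)
  have h2 : ContDiffAt ℝ j (aliasKT φ H (truncAmp H w T) (-k)) x :=
    (contDiff_aliasKT_truncAmp (H := H) hφ hwc hT (-k)).contDiffAt.of_le (mod_cast le_top)
  unfold aliasPairT
  exact iteratedDeriv_fun_add h1 h2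

/-- **Fubini for the symmetric kernel.** For continuous compactly supported `G` with
`Ĝ(τ) = ∫ G(x) e^{ixτ} dx`:
`∫_{τ>H} Ĝ(τ) a_T(τ) (e^{2πikφ(τ)} + e^{-2πikφ(τ)}) dτ = ∫ G(x) P_T(k)(x) dx`. [folklore] -/
theorem integral_ft_mul_truncAmp_pair (hφ : Continuous φ) (hwc : Continuous w) {T : ℝ}
    (hT : 0 < T) (k : ℤ) {G : ℝ → ℂ} (hG : Continuous G) (hGs : HasCompactSupport G) :
    ∫ τ in Ioi H, (∫ x, G x * exp (((x * τ : ℝ) : ℂ) * I)) * (truncAmp H w T τ : ℂ) *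
        (exp (((2 * π * k * φ τ : ℝ) : ℂ) * I) + exp (((2 * π * (-k : ℤ) * φ τ : ℝ) : ℂ) * I)) =
      ∫ x, G x * aliasPairT φ H w T k x := by
  have hz := fun (τ : ℝ) (hτ : τ < H + 1 / 4) => truncAmp_eq_zero_of_lt (H := H) (w := w) T hτ
  have hR := fun (τ : ℝ) (hτ : 2 * T < τ) => truncAmp_eq_zero_of_gt (H := H) (w := w) hT hτ
  have e1 := integral_ft_mul_eq_integral_mul_aliasKT hφ (continuous_truncAmp hwc T) hz hR k hG hGs
  have e2 := integral_ft_mul_eq_integral_mul_aliasKT hφ (continuous_truncAmp hwc T) hz hR (-k)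
    hG hGs
  -- integrability of the two pieces (continuous, compactly supported in `τ`)
  have hFc : Continuous fun τ : ℝ => ∫ x, G x * exp (((x * τ : ℝ) : ℂ) * I) := by
    have heq : (fun τ : ℝ => ∫ x, G x * exp (((x * τ : ℝ) : ℂ) * I)) =
        fun τ : ℝ => ∫ x in tsupport G, G x * exp (((x * τ : ℝ) : ℂ) * I) := by
      funext τ
      refine (setIntegral_eq_integral_of_forall_compl_eq_zero fun x hx => ?_).symm
      simp [image_eq_zero_of_notMem_tsupport hx]
    rw [heq]
    exact continuous_parametric_integral_of_continuous
      (f := fun (τ : ℝ) (x : ℝ) => G x * exp (((x * τ : ℝ) : ℂ) * I)) (by fun_prop) hGs.isCompact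
  have hint : ∀ k' : ℤ, IntegrableOn (fun τ => (∫ x, G x * exp (((x * τ : ℝ) : ℂ) * I)) *
      (truncAmp H w T τ : ℂ) * exp (((2 * π * k' * φ τ : ℝ) : ℂ) * I)) (Ioi H) := by
    intro k'
    refine integrableOn_Ioi_of_zero (R := 2 * T) ?_ (fun τ hτ => by simp [hz τ hτ])
      (fun τ hτ => by simp [hR τ hτ])
    exact ((hFc.mul (Complex.continuous_ofReal.comp (continuous_truncAmp hwc T))).mul
      (by fun_prop)).continuousOn
  have hGi : ∀ k' : ℤ, Integrable fun x => G x * aliasKT φ H (truncAmp H w T) k' x := fun k' =>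
    (hG.mul (contDiff_aliasKT_truncAmp hφ hwc hT k').continuous).integrable_of_hasCompactSupport
      hGs.mul_right
  simp_rw [mul_add]
  rw [integral_add (hint k) (hint (-k)), e1, e2, ← integral_add (hGi k) (hGi (-k))]
  simp only [aliasPairT, mul_add]

end Pair

/-! ## The smooth limit kernel -/

section Limit

variable {φ : ℝ → ℝ} {H L : ℝ} {Cφ : ℕ → ℝ} (hφ : ChirpPhase φ H L Cφ)
  {w : ℝ → ℝ} (hwc : Continuous w) (hws : ContDiffOn ℝ ∞ w (Ioi H))
  (hwb : ∀ R, SymBnd (univ : Set Unit) H 0 R (fun _ => w))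
  {c' : ℝ} (hc' : 0 ≤ c') (hcL : c' < 2 * π * L)

include hφ hwc hws hwb hc' hcL in
/-- Uniform `C^j` Cauchy control of the symmetric kernels, with one constant for all `j' ≤ j`
and all modes `k + 1`, `k ∈ ℕ`. [folklore] -/
theorem exists_iteratedDeriv_aliasPairT_sub_le (j : ℕ) :
    ∃ C, 0 ≤ C ∧ ∀ j' ≤ j, ∀ k : ℕ, ∀ x : ℝ, |x| ≤ c' → ∀ T T' : ℝ, 1 ≤ T → 1 ≤ T' →
      ‖iteratedDeriv j' (aliasPairT φ H w T (k + 1)) x -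
        iteratedDeriv j' (aliasPairT φ H w T' (k + 1)) x‖ ≤ C * (min T T') ^ (-(1 / 2) : ℝ) := by
  choose C hC0 hC using
    fun j' => exists_iteratedDeriv_aliasKT_truncAmp_sub_le hφ hwc hws hwb hc' hcL j'
  refine ⟨2 * ∑ j' ∈ Finset.range (j + 1), C j',
    mul_nonneg zero_le_two (Finset.sum_nonneg fun i _ => hC0 i),
    fun j' hj' k x hx T T' hT hT' => ?_⟩
  have hk : ((k : ℤ) + 1) ≠ 0 := by omega
  have hk' : (-((k : ℤ) + 1)) ≠ 0 := by omega
  have hT0 : 0 < T := by linarith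
  have hT0' : 0 < T' := by linarith
  have hφc := hφ.smooth.continuous
  rw [iteratedDeriv_aliasPairT hφc hwc hT0, iteratedDeriv_aliasPairT hφc hwc hT0']
  have e1 := hC j' ((k : ℤ) + 1) hk x hx T T' hT hT'
  have e2 := hC j' (-((k : ℤ) + 1)) hk' x hx T T' hT hT'
  have hle : C j' ≤ ∑ j' ∈ Finset.range (j + 1), C j' :=
    Finset.single_le_sum (fun i _ => hC0 i) (Finset.mem_range.mpr (Nat.lt_succ_of_le hj'))
  have hr : 0 ≤ (min T T') ^ (-(1 / 2) : ℝ) := Real.rpow_nonneg (le_min hT0.le hT0'.le) _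
  calc _ ≤ ‖iteratedDeriv j' (aliasKT φ H (truncAmp H w T) (k + 1)) x -
          iteratedDeriv j' (aliasKT φ H (truncAmp H w T') (k + 1)) x‖ +
        ‖iteratedDeriv j' (aliasKT φ H (truncAmp H w T) (-(k + 1))) x -
          iteratedDeriv j' (aliasKT φ H (truncAmp H w T') (-(k + 1))) x‖ := by
        rw [add_sub_add_comm]; exact norm_add_le _ _
    _ ≤ C j' * (min T T') ^ (-(1 / 2) : ℝ) + C j' * (min T T') ^ (-(1 / 2) : ℝ) := add_le_add e1 e2
    _ ≤ _ := by nlinarith [mul_le_mul_of_nonneg_right hle hr]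

include hφ hwc hws hwb hc' hcL in
/-- Uniform `C^j` bounds of the symmetric kernels, one constant for all `j' ≤ j`. [folklore] -/
theorem exists_iteratedDeriv_aliasPairT_le (j : ℕ) :
    ∃ C, 0 ≤ C ∧ ∀ j' ≤ j, ∀ k : ℕ, ∀ x : ℝ, |x| ≤ c' → ∀ T : ℝ, 1 ≤ T →
      ‖iteratedDeriv j' (aliasPairT φ H w T (k + 1)) x‖ ≤ C := by
  choose C hC0 hC using
    fun j' => exists_iteratedDeriv_aliasKT_truncAmp_le hφ hwc hws hwb hc' hcL j'
  refine ⟨2 * ∑ j' ∈ Finset.range (j + 1), C j',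
    mul_nonneg zero_le_two (Finset.sum_nonneg fun i _ => hC0 i), fun j' hj' k x hx T hT => ?_⟩
  have hk : ((k : ℤ) + 1) ≠ 0 := by omega
  have hk' : (-((k : ℤ) + 1)) ≠ 0 := by omega
  have hT0 : 0 < T := by linarith
  rw [iteratedDeriv_aliasPairT hφ.smooth.continuous hwc hT0]
  have e1 := hC j' ((k : ℤ) + 1) hk x hx T hT
  have e2 := hC j' (-((k : ℤ) + 1)) hk' x hx T hT
  have hle : C j' ≤ ∑ j' ∈ Finset.range (j + 1), C j' :=
    Finset.single_le_sum (fun i _ => hC0 i) (Finset.mem_range.mpr (Nat.lt_succ_of_le hj'))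
  linarith [norm_add_le (iteratedDeriv j' (aliasKT φ H (truncAmp H w T) (k + 1)) x)
    (iteratedDeriv j' (aliasKT φ H (truncAmp H w T) (-(k + 1))) x)]

include hφ hwc hws hwb hc' hcL in
/-- The uniform bound at level zero: `‖P_T(k+1)(x)‖ ≤ C` for `|x| ≤ c'`, `T ≥ 1`. [folklore] -/
theorem exists_aliasPairT_le :
    ∃ C, 0 ≤ C ∧ ∀ k : ℕ, ∀ x : ℝ, |x| ≤ c' → ∀ T : ℝ, 1 ≤ T →
      ‖aliasPairT φ H w T (k + 1) x‖ ≤ C := by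
  obtain ⟨C, hC0, hC⟩ := exists_iteratedDeriv_aliasPairT_le hφ hwc hws hwb hc' hcL 0
  exact ⟨C, hC0, fun k x hx T hT => by simpa using hC 0 le_rfl k x hx T hT⟩

variable {χ : ℝ → ℂ} (hχ : ContDiff ℝ ∞ χ) (hχs : tsupport χ ⊆ Icc (-c') c')

include hφ hwc hχ in
/-- The partial sums are smooth. [folklore] -/
theorem contDiff_aliasSum (m : ℕ) : ContDiff ℝ ∞ (aliasSum φ H w χ m) := by
  have hm : (0 : ℝ) < m + 1 := by positivity
  unfold aliasSum
  refine ContDiff.sum fun k _ => contDiff_const.mul (hχ.mul ?_)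
  exact contDiff_aliasPairT hφ.smooth.continuous hwc hm _

include hφ hwc hχ in
/-- Derivatives of the partial sums, term by term. [folklore] -/
theorem iteratedDeriv_aliasSum (j m : ℕ) (x : ℝ) :
    iteratedDeriv j (aliasSum φ H w χ m) x = ∑ k ∈ Finset.range m, (b2coef k : ℂ) *
      iteratedDeriv j (fun y => χ y * aliasPairT φ H w (m + 1) (k + 1) y) x := by
  have hm : (0 : ℝ) < m + 1 := by positivity
  have hsm : ∀ k : ℕ, ContDiff ℝ ∞ (fun y => χ y * aliasPairT φ H w (m + 1) (k + 1) y) :=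
    fun k => hχ.mul (contDiff_aliasPairT hφ.smooth.continuous hwc hm _)
  have hat : ∀ k : ℕ, ContDiffAt ℝ j (fun y => χ y * aliasPairT φ H w (m + 1) (k + 1) y) x :=
    fun k => (hsm k).contDiffAt.of_le (mod_cast le_top)
  unfold aliasSum
  rw [iteratedDeriv_fun_sum (f := fun (k : ℕ) (y : ℝ) =>
    (b2coef k : ℂ) * (χ y * aliasPairT φ H w (m + 1) (k + 1) y))
    fun k _ => contDiffAt_const.mul (hat k)]
  exact Finset.sum_congr rfl fun k _ => iteratedDeriv_const_mul _ (hat k)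

include hφ hwc hws hwb hc' hcL hχ hχs in
/-- **The smooth alias kernel.** The cut-off partial sums `S_m` converge uniformly on `ℝ`, with
all derivatives, to a smooth function `K` (so `K = Σ_{k≥1} b_k χ · lim_T P_T(k)`).
[folklore] -/
theorem exists_contDiff_tendstoUniformly_aliasSum :
    ∃ K : ℝ → ℂ, ContDiff ℝ ∞ K ∧ TendstoUniformly (aliasSum φ H w χ) K atTop := by
  have hsm := contDiff_aliasSum hφ hwc hχ (H := H)
  suffices hC : ∀ j : ℕ, ∀ ε > (0 : ℝ), ∃ N : ℕ, ∀ m ≥ N, ∀ m' ≥ N, ∀ x : ℝ,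
      ‖iteratedDeriv j (aliasSum φ H w χ m) x - iteratedDeriv j (aliasSum φ H w χ m') x‖ < ε by
    obtain ⟨K, hK, hlim⟩ := exists_contDiff_limit_of_uniformCauchy hsm hC
    exact ⟨K, hK, by simpa using hlim 0⟩
  intro j
  obtain ⟨M, hM0, hM⟩ := exists_iteratedDeriv_cutoff_mul_le hχ hχs j
  obtain ⟨C₁, hC₁, hcau⟩ := exists_iteratedDeriv_aliasPairT_sub_le hφ hwc hws hwb hc' hcL j
  obtain ⟨C₂, hC₂, hbd⟩ := exists_iteratedDeriv_aliasPairT_le hφ hwc hws hwb hc' hcL j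
  have hφc := hφ.smooth.continuous
  -- the cut-off pairs `D T k x = (χ P_T(k+1))^{(j)}(x)`
  set D : ℝ → ℕ → ℝ → ℂ := fun T k x =>
    iteratedDeriv j (fun y => χ y * aliasPairT φ H w T (k + 1) y) x with hD
  have hA : ∀ k x T T', 1 ≤ T → 1 ≤ T' →
      ‖D T k x - D T' k x‖ ≤ M * C₁ * (min T T') ^ (-(1 / 2) : ℝ) := by
    intro k x T T' hT hT'
    have hT0 : 0 < T := by linarith
    have hT0' : 0 < T' := by linarith
    have hp := contDiff_aliasPairT hφc hwc hT0 ((k : ℤ) + 1) (H := H)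
    have hp' := contDiff_aliasPairT hφc hwc hT0' ((k : ℤ) + 1) (H := H)
    have hr : 0 ≤ (min T T') ^ (-(1 / 2) : ℝ) := Real.rpow_nonneg (le_min hT0.le hT0'.le) _
    have key := hM (fun y => aliasPairT φ H w T (k + 1) y - aliasPairT φ H w T' (k + 1) y)
      (hp.sub hp') (C₁ * (min T T') ^ (-(1 / 2) : ℝ)) (mul_nonneg hC₁ hr) ?_ x
    · rw [mul_assoc]
      refine le_of_eq_of_le ?_ key
      simp only [hD]
      rw [← iteratedDeriv_fun_sub ((hχ.mul hp).contDiffAt.of_le (mod_cast le_top))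
        ((hχ.mul hp').contDiffAt.of_le (mod_cast le_top))]
      have hfg : (fun y => χ y * aliasPairT φ H w T (k + 1) y - χ y * aliasPairT φ H w T' (k + 1) y)
          = fun y => χ y * (aliasPairT φ H w T (k + 1) y - aliasPairT φ H w T' (k + 1) y) := by
        funext y; ring
      rw [hfg]
    · intro j' hj' y hy
      rw [iteratedDeriv_fun_sub (hp.contDiffAt.of_le (mod_cast le_top))
        (hp'.contDiffAt.of_le (mod_cast le_top))]
      exact hcau j' hj' k y hy T T' hT hT'
  have hB : ∀ k x T, 1 ≤ T → ‖D T k x‖ ≤ M * C₂ := by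
    intro k x T hT
    have hT0 : 0 < T := by linarith
    have hp := contDiff_aliasPairT hφc hwc hT0 ((k : ℤ) + 1) (H := H)
    exact hM _ hp C₂ hC₂ (fun j' hj' y hy => hbd j' hj' k y hy T hT) x
  have hU := uniformCauchy_sum_of_bounds (D := D) b2coef_nonneg summable_b2coef
    (mul_nonneg hM0 hC₁) (mul_nonneg hM0 hC₂) hA hB
  intro ε hε
  obtain ⟨N, hN⟩ := hU ε hε
  refine ⟨N, fun m hm m' hm' x => ?_⟩
  rw [iteratedDeriv_aliasSum hφ hwc hχ, iteratedDeriv_aliasSum hφ hwc hχ]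
  exact hN m hm m' hm' x

include hφ hwc in
/-- Pairing a continuous compactly supported `G` with the partial sums, term by term.
[folklore] -/
theorem integral_mul_aliasSum (hχc : Continuous χ) {G : ℝ → ℂ} (hG : Continuous G)
    (hGs : HasCompactSupport G) (m : ℕ) :
    ∫ x, G x * aliasSum φ H w χ m x = ∑ k ∈ Finset.range m,
      (b2coef k : ℂ) * ∫ x, G x * (χ x * aliasPairT φ H w (m + 1) (k + 1) x) := by
  have hm : (0 : ℝ) < m + 1 := by positivity
  have hint : ∀ k : ℕ, Integrable fun x => G x * ((b2coef k : ℂ) *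
      (χ x * aliasPairT φ H w (m + 1) (k + 1) x)) := fun k =>
    (hG.mul (continuous_const.mul (hχc.mul
      (contDiff_aliasPairT hφ.smooth.continuous hwc hm _).continuous))).integrable_of_hasCompactSupport
      hGs.mul_right
  simp only [aliasSum, Finset.mul_sum]
  rw [integral_finsetSum _ fun k _ => hint k]
  refine Finset.sum_congr rfl fun k _ => ?_
  rw [← integral_const_mul]
  exact integral_congr_ae (Eventually.of_forall fun x => by ring)

end Limit

end Literature.Analysis.Fourier
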